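import Literature.AlgebraicGeometry.Smoothening.JacobianCriterion
import Mathlib.RingTheory.TensorProduct.MvPolynomial
import Mathlib.RingTheory.Spectrum.Prime.Basic
import Mathlib.Algebra.MvPolynomial.Nilpotent
import HarnessLib

/-!
# The chart algebra of the universal hyperplane section: elimination of one dual coordinate

Topic `Literature/AlgebraicGeometry/Motives`; pure commutative algebra (definitions + theorems, no
named facts) behind the local structure of the universal hyperplane section
`𝒳 = {(x, a) | Σᵢ aᵢ xᵢ = 0} ⊆ X ×ₖ (ℙᴺ)^*` over an affine chart (`Motives/UniversalHyperplaneSectionChart`):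
on `X' ×ₖ D₊(a_l)`, `X' ⊆ ι⁻¹D₊(x_j)` affine with ring `A = Γ(X, X')`, `j ≠ l`, the incidence equation is
`g = Σᵢ uᵢ ⊗ aᵢ/a_l` with `u_j = 1`, so `𝒳 ∩ (X' ×ₖ D₊(a_l))` is the GRAPH of
`a_j/a_l = -(u_l + Σ_{i ≠ j, l} uᵢ aᵢ/a_l)` over `X' × 𝔸ᴺ⁻¹` (Voisin II §2.1.1: the incidence variety
is a projective bundle over `X`; §3.2.2). In coordinates `y_m = a_{l.succAbove m}/a_l` on
`D₊(a_l) ≅ 𝔸ᴺ = Spec k[y₁, …, y_N]`, with `y_{m₀} = a_j/a_l`, `w_m = u_{l.succAbove m}`, `w₀ = u_l`: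

* `Model A m₀ = A[y_m : m ≠ m₀]`, `G = w₀ + Σ_{m ≠ m₀} w_m y_m`, the elimination
  `elim : A[y] → A[y_m : m ≠ m₀]`, `y_{m₀} ↦ -G` (surjective), `incidence = w₀ + Σ_m w_m y_m`;
  `elim_incidence` (`g ↦ 0` when `w_{m₀} = 1`) and **`zeroLocus_ker_elim`: `V(ker elim) = V(g)`**;
* the same read in the chart ring `A ⊗ₖ k[y]` (`tensorEquiv = MvPolynomial.algebraTensorAlgEquiv`,
  `incidenceTensor`, `elimTensor`, `zeroLocus_ker_elimTensor`);
* the `k[y]`-algebra structure `modelAlgebra` of the model (`y ↦ subst`) and **its presentation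
  `presentationAlgEquiv : k[y][T₁, …, T_m]/(f₁, …, f_c, h) ≃ₐ[k[y]] A[y_m : m ≠ m₀]`** from a
  presentation `k[T]/(f₁, …, f_c) ≃ A` of `A` (`rels = (f, h)`, `h = Σ_m y_m U_m(T) + U₀(T)` for lifts
  `U` of the `w`; maps `fwd`, `bwd`, `fwd_comp_bwd`, `bwd_comp_fwd`), the input of the fibrewise
  Jacobian criterion (`Smoothening/JacobianCriterionFibre`) for the smoothness of `π : 𝒳 → (ℙᴺ)^*`;
* `exists_fin_presentation`: a standard smooth `k`-algebra of relative dimension `d` has a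
  presentation `k[T₁, …, T_m]/(f₁, …, f_c)` with `m - c = d`, `c ≤ m` (Mathlib's submersive
  presentations reindexed by `Fin`).

## References

* [VoisinHodgeII2003] C. Voisin, Hodge Theory and Complex Algebraic Geometry II, CUP 2003, §2.1.1,
  §3.2.2.
* [Hartshorne1977] R. Hartshorne, Algebraic Geometry, II Ex. 5.11 (elimination), III §10.
-/

noncomputable section

open scoped TensorProduct
open MvPolynomial

namespace Literature.AlgebraicGeometry.Motives.HyperplaneSectionChart

universe u

/-! ### The model `A[y_m : m ≠ m₀]` and the substitution `y_{m₀} ↦ -(w₀ + Σ_{m ≠ m₀} w_m y_m)` -/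

section Model

variable (k : Type u) [CommRing k] (A : Type u) [CommRing A] [Algebra k A]
  {M : ℕ} (m₀ : Fin M) (w : Fin M → A) (w₀ : A)

/-- The indices of the dual coordinates kept: all `m ≠ m₀`. [folklore] -/
abbrev Idx : Type := {m : Fin M // m ≠ m₀}

/-- The model ring `A[y_m : m ≠ m₀]` of the chart of the universal hyperplane section (the graph of
`y_{m₀} = -(w₀ + Σ_{m ≠ m₀} w_m y_m)` over `Spec A × 𝔸^{M-1}`). [cite: VoisinHodgeII2003, §2.1.1] -/
abbrev Model : Type u := MvPolynomial (Idx m₀) A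

/-- `G = w₀ + Σ_{m ≠ m₀} w_m y_m ∈ A[y_m : m ≠ m₀]`. [folklore] -/
def G : Model A m₀ := C w₀ + ∑ m : Idx m₀, C (w m.1) * X m

/-- The substitution of the dual coordinates: `y_m ↦ y_m` for `m ≠ m₀` and `y_{m₀} ↦ -G`. [folklore] -/
def subst (m : Fin M) : Model A m₀ := if h : m = m₀ then -G A m₀ w w₀ else X ⟨m, h⟩

/-- `subst` on a kept variable. [folklore] -/
theorem subst_of_ne {m : Fin M} (h : m ≠ m₀) : subst A m₀ w w₀ m = X ⟨m, h⟩ := by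
  simp [subst, h]

/-- `subst` on the eliminated variable. [folklore] -/
@[simp]
theorem subst_self : subst A m₀ w w₀ m₀ = -G A m₀ w w₀ := by
  simp [subst]

/-- The elimination map `A[y₁, …, y_M] → A[y_m : m ≠ m₀]` (an `A`-algebra surjection). [folklore] -/
def elim : MvPolynomial (Fin M) A →ₐ[A] Model A m₀ := aeval (subst A m₀ w w₀)

/-- The incidence equation `g = w₀ + Σ_m w_m y_m ∈ A[y₁, …, y_M]`. [folklore] -/
def incidence : MvPolynomial (Fin M) A := C w₀ + ∑ m : Fin M, C (w m) * X m

variable {A m₀ w w₀}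

/-- Splitting a sum over `Fin M` at `m₀`: `Σ_m F m = F m₀ + Σ_{m ≠ m₀} F m`. [folklore] -/
theorem sum_eq_add_sum_subtype {β : Type*} [AddCommMonoid β] (F : Fin M → β) :
    ∑ m, F m = F m₀ + ∑ m : Idx m₀, F m.1 := by
  rw [← Finset.add_sum_erase _ _ (Finset.mem_univ m₀)]
  congr 1
  refine (Finset.sum_subtype (Finset.univ.erase m₀) (fun m ↦ ?_) F)
  simp

/-- **`g ↦ 0` under the elimination** when `w_{m₀} = 1`:
`elim g = w₀ + (-G) · 1 + Σ_{m ≠ m₀} w_m y_m = 0`. [folklore] -/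
theorem elim_incidence (hw : w m₀ = 1) : elim A m₀ w w₀ (incidence A w w₀) = 0 := by
  simp only [elim, incidence, map_add, map_sum, map_mul, aeval_C, aeval_X,
    sum_eq_add_sum_subtype (m₀ := m₀), hw, map_one, one_mul, subst_self]
  have h : ∀ m : Idx m₀, subst A m₀ w w₀ m.1 = X m := fun m ↦ subst_of_ne A m₀ w w₀ m.2
  simp only [h, G, algebraMap_eq]
  ring

/-- The elimination map is surjective (`y_m`, `m ≠ m₀`, is hit by `y_m`). [folklore] -/
theorem elim_surjective : Function.Surjective (elim A m₀ w w₀) := fun p ↦ by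
  refine ⟨rename (fun m : Idx m₀ ↦ m.1) p, ?_⟩
  rw [elim, aeval_rename]
  have h : (fun m : Idx m₀ ↦ subst A m₀ w w₀ m.1) = X := funext fun m ↦ subst_of_ne A m₀ w w₀ m.2
  rw [show (subst A m₀ w w₀ ∘ fun m : Idx m₀ ↦ m.1) = fun m ↦ subst A m₀ w w₀ m.1 from rfl, h, aeval_X_left,
    AlgHom.id_apply]

/-- **The support of the kernel of the elimination is `{g = 0}`**: a prime `𝔓 ∋ g` of `A[y]`
contains `ker elim`, because modulo `𝔓` one has `y_{m₀} = -(w₀ + Σ_{m ≠ m₀} w_m y_m)`, so that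
`A[y] → A[y]/𝔓` factors through the elimination (when `w_{m₀} = 1`). [folklore] -/
theorem ker_elim_le_of_incidence_mem (hw : w m₀ = 1) {P : Ideal (MvPolynomial (Fin M) A)}
    (hP : incidence A w w₀ ∈ P) : RingHom.ker (elim A m₀ w w₀) ≤ P := by
  -- the factorisation `A[y_m : m ≠ m₀] → A[y]/𝔓`, `y_m ↦ y_m`
  let φ : Model A m₀ →ₐ[A] MvPolynomial (Fin M) A ⧸ P :=
    aeval fun m : Idx m₀ ↦ Ideal.Quotient.mk P (X m.1)
  have hC : ∀ a : A, algebraMap A (MvPolynomial (Fin M) A ⧸ P) a = Ideal.Quotient.mk P (C a) :=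
    fun a ↦ rfl
  have hG : φ (G A m₀ w w₀) = -Ideal.Quotient.mk P (X m₀) := by
    have h1 : Ideal.Quotient.mk P (incidence A w w₀) = 0 := Ideal.Quotient.eq_zero_iff_mem.2 hP
    rw [incidence, map_add, map_sum, sum_eq_add_sum_subtype (m₀ := m₀), map_mul, hw, C_1, map_one,
      one_mul] at h1
    simp only [map_mul] at h1
    have e1 : φ (G A m₀ w w₀) = Ideal.Quotient.mk P (C w₀) +
        ∑ m : Idx m₀, Ideal.Quotient.mk P (C (w m.1)) * Ideal.Quotient.mk P (X m.1) := by
      simp only [G, map_add, map_sum, map_mul, φ, aeval_C, aeval_X, hC]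
    rw [e1]
    linear_combination h1
  have hcomp : ∀ p, φ (elim A m₀ w w₀ p) = Ideal.Quotient.mk P p := by
    intro p
    change (φ.comp (elim A m₀ w w₀)) p = (Ideal.Quotient.mkₐ A P) p
    congr 1
    refine MvPolynomial.algHom_ext fun m ↦ ?_
    simp only [AlgHom.comp_apply, Ideal.Quotient.mkₐ_eq_mk, elim, aeval_X]
    by_cases hm : m = m₀
    · subst hm
      rw [subst_self, map_neg, hG, neg_neg]
    · rw [subst_of_ne A m₀ w w₀ hm]
      simp [φ]
  intro p hp
  rw [RingHom.mem_ker] at hp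
  rw [← Ideal.Quotient.eq_zero_iff_mem, ← hcomp, hp, map_zero]

/-- **The zero locus of `ker elim` is `{g = 0}`** (`g ∈ ker elim`, and the previous lemma).
[folklore] -/
theorem zeroLocus_ker_elim (hw : w m₀ = 1) :
    PrimeSpectrum.zeroLocus (RingHom.ker (elim A m₀ w w₀) : Set (MvPolynomial (Fin M) A)) =
      PrimeSpectrum.zeroLocus {incidence A w w₀} := by
  apply le_antisymm
  · intro P hP
    rw [PrimeSpectrum.mem_zeroLocus, Set.singleton_subset_iff]
    exact hP ((RingHom.mem_ker).2 (elim_incidence hw))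
  · intro P hP
    rw [PrimeSpectrum.mem_zeroLocus, Set.singleton_subset_iff] at hP
    exact ker_elim_le_of_incidence_mem hw hP

end Model

/-! ### The chart ring `A ⊗ₖ k[y]` and the elimination -/

section Tensor

variable (k : Type u) [CommRing k] (A : Type u) [CommRing A] [Algebra k A]
  {M : ℕ} (m₀ : Fin M) (w : Fin M → A) (w₀ : A)

/-- `A ⊗ₖ k[y₁, …, y_M] ≅ A[y₁, …, y_M]` (Mathlib `MvPolynomial.algebraTensorAlgEquiv`). [folklore] -/
abbrev tensorEquiv : A ⊗[k] MvPolynomial (Fin M) k ≃ₐ[A] MvPolynomial (Fin M) A :=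
  MvPolynomial.algebraTensorAlgEquiv k A

/-- The incidence equation read in `A ⊗ₖ k[y]`: `w₀ ⊗ 1 + Σ_m w_m ⊗ y_m`. [folklore] -/
def incidenceTensor : A ⊗[k] MvPolynomial (Fin M) k :=
  w₀ ⊗ₜ[k] 1 + ∑ m : Fin M, w m ⊗ₜ[k] X m

/-- `A ⊗ k[y] ≅ A[y]` sends `w₀ ⊗ 1 + Σ w_m ⊗ y_m` to `g = w₀ + Σ w_m y_m`. [folklore] -/
theorem tensorEquiv_incidenceTensor :
    tensorEquiv k A (incidenceTensor k A w w₀ (M := M)) = incidence A w w₀ := by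
  simp only [incidenceTensor, incidence, map_add, map_sum, MvPolynomial.algebraTensorAlgEquiv_tmul,
    map_one, MvPolynomial.map_X, MvPolynomial.smul_eq_C_mul, mul_one]

/-- **The elimination on the chart ring** `θ : A ⊗ₖ k[y] → A[y_m : m ≠ m₀]`,
`a ⊗ y_m ↦ a y_m` (`m ≠ m₀`), `a ⊗ y_{m₀} ↦ -a G`. [folklore] -/
def elimTensor : A ⊗[k] MvPolynomial (Fin M) k →ₐ[A] Model A m₀ :=
  (elim A m₀ w w₀).comp (tensorEquiv k A).toAlgHom

/-- `θ` is surjective. [folklore] -/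
theorem elimTensor_surjective : Function.Surjective (elimTensor k A m₀ w w₀) :=
  elim_surjective.comp (tensorEquiv k A).surjective

/-- `θ` kills the incidence equation (when `w_{m₀} = 1`). [folklore] -/
theorem elimTensor_incidenceTensor (hw : w m₀ = 1) :
    elimTensor k A m₀ w w₀ (incidenceTensor k A w w₀) = 0 := by
  change elim A m₀ w w₀ (tensorEquiv k A (incidenceTensor k A w w₀)) = 0
  rw [tensorEquiv_incidenceTensor]
  exact elim_incidence hw

/-- `θ (1 ⊗ p) = p(subst)`: on `k[y] ⊆ A ⊗ₖ k[y]` the elimination is the substitution of the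
dual coordinates. [folklore] -/
theorem elimTensor_one_tmul (p : MvPolynomial (Fin M) k) :
    elimTensor k A m₀ w w₀ ((1 : A) ⊗ₜ[k] p) = aeval (R := k) (subst A m₀ w w₀) p := by
  change elim A m₀ w w₀ (tensorEquiv k A ((1 : A) ⊗ₜ[k] p)) = _
  rw [tensorEquiv, MvPolynomial.algebraTensorAlgEquiv_tmul, one_smul, elim, aeval_map_algebraMap]

/-- **The zero locus of `ker θ` is `{w₀ ⊗ 1 + Σ w_m ⊗ y_m = 0}`** (transport of `zeroLocus_ker_elim`
along `A ⊗ k[y] ≅ A[y]`). [folklore] -/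
theorem zeroLocus_ker_elimTensor (hw : w m₀ = 1) :
    PrimeSpectrum.zeroLocus (RingHom.ker (elimTensor k A m₀ w w₀) : Set (A ⊗[k] MvPolynomial (Fin M) k)) =
      PrimeSpectrum.zeroLocus {incidenceTensor k A w w₀} := by
  set ε := tensorEquiv k A (M := M) with hε
  have hker : RingHom.ker (elimTensor k A m₀ w w₀) =
      Ideal.comap ε.toRingEquiv.toRingHom (RingHom.ker (elim A m₀ w w₀)) := by
    ext z
    simp only [RingHom.mem_ker, Ideal.mem_comap]
    rfl
  ext P
  rw [PrimeSpectrum.mem_zeroLocus, PrimeSpectrum.mem_zeroLocus, Set.singleton_subset_iff, SetLike.mem_coe,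
    hker]
  -- `comap ε (ker elim) ≤ P ↔ ker elim ≤ comap ε⁻¹ P ↔ g ∈ comap ε⁻¹ P ↔ ε⁻¹ g ∈ P`
  have key : Ideal.comap ε.toRingEquiv.toRingHom (RingHom.ker (elim A m₀ w w₀)) ≤ P.asIdeal ↔
      RingHom.ker (elim A m₀ w w₀) ≤ Ideal.comap ε.symm.toRingEquiv.toRingHom P.asIdeal := by
    constructor
    · intro h x hx
      rw [Ideal.mem_comap]
      apply h
      rw [Ideal.mem_comap]
      change ε (ε.symm x) ∈ _
      rwa [AlgEquiv.apply_symm_apply]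
    · intro h x hx
      rw [Ideal.mem_comap] at hx
      have := h hx
      rw [Ideal.mem_comap] at this
      change ε.symm (ε x) ∈ _ at this
      rwa [AlgEquiv.symm_apply_apply] at this
  have hP' : (⟨Ideal.comap ε.symm.toRingEquiv.toRingHom P.asIdeal, Ideal.comap_isPrime _ _⟩ :
      PrimeSpectrum (MvPolynomial (Fin M) A)) ∈
        PrimeSpectrum.zeroLocus (RingHom.ker (elim A m₀ w w₀) : Set (MvPolynomial (Fin M) A)) ↔
      (⟨Ideal.comap ε.symm.toRingEquiv.toRingHom P.asIdeal, Ideal.comap_isPrime _ _⟩ :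
        PrimeSpectrum (MvPolynomial (Fin M) A)) ∈ PrimeSpectrum.zeroLocus {incidence A w w₀} := by
    rw [zeroLocus_ker_elim hw]
  rw [PrimeSpectrum.mem_zeroLocus, PrimeSpectrum.mem_zeroLocus, Set.singleton_subset_iff] at hP'
  rw [SetLike.coe_subset_coe, key, ← SetLike.coe_subset_coe]
  refine hP'.trans ?_
  rw [SetLike.mem_coe, Ideal.mem_comap, ← tensorEquiv_incidenceTensor k A w w₀, ← hε]
  change ε.symm (ε _) ∈ P.asIdeal ↔ _
  rw [AlgEquiv.symm_apply_apply]

end Tensor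

/-! ### The presentation of the model over `k[y]` -/

section Presentation

variable (k : Type u) [CommRing k] (A : Type u) [CommRing A] [Algebra k A]
  {M : ℕ} (m₀ : Fin M) (w : Fin M → A) (w₀ : A)
  {mT c : ℕ} (f₀ : Fin c → MvPolynomial (Fin mT) k)
  (eA : (MvPolynomial (Fin mT) k ⧸ Ideal.span (Set.range f₀)) ≃ₐ[k] A)
  (U : Fin M → MvPolynomial (Fin mT) k) (U₀ : MvPolynomial (Fin mT) k)

/-- The `k[y]`-algebra structure of the model `A[y_m : m ≠ m₀]`: `y_m ↦ y_m` (`m ≠ m₀`),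
`y_{m₀} ↦ -G` (the dual coordinates restricted to the graph). A `def` to be installed with `letI`
(it depends on `w`, `w₀`). [folklore] -/
@[reducible]
def modelAlgebra : Algebra (MvPolynomial (Fin M) k) (Model A m₀) :=
  (aeval (R := k) (subst A m₀ w w₀)).toRingHom.toAlgebra

/-- Unfolding of the structure map of `modelAlgebra`. [folklore] -/
theorem modelAlgebra_algebraMap (b : MvPolynomial (Fin M) k) :
    letI := modelAlgebra k A m₀ w w₀
    algebraMap (MvPolynomial (Fin M) k) (Model A m₀) b = aeval (subst A m₀ w w₀) b := rfl

/-- `k → k[y] → A[y'']` is the scalar action of `k`. [folklore] -/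
theorem modelAlgebra_isScalarTower :
    letI := modelAlgebra k A m₀ w w₀
    IsScalarTower k (MvPolynomial (Fin M) k) (Model A m₀) :=
  letI := modelAlgebra k A m₀ w w₀
  IsScalarTower.of_algebraMap_eq fun c ↦ ((aeval (R := k) (subst A m₀ w w₀)).commutes c).symm

/-- The additional relation `h = Σ_m y_m · U_m(T) + U₀(T) ∈ k[y][T]` (the incidence equation with the
`wᵢ` replaced by polynomial lifts `Uᵢ`). [folklore] -/
def relH : MvPolynomial (Fin mT) (MvPolynomial (Fin M) k) :=
  (∑ m : Fin M, C (X m) * MvPolynomial.map (algebraMap k (MvPolynomial (Fin M) k)) (U m)) +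
    MvPolynomial.map (algebraMap k (MvPolynomial (Fin M) k)) U₀

/-- The relations of the model over `k[y]`: those of `A` (base-changed) and `h`. [folklore] -/
def rels : Fin (c + 1) → MvPolynomial (Fin mT) (MvPolynomial (Fin M) k) :=
  Fin.snoc (fun i ↦ MvPolynomial.map (algebraMap k (MvPolynomial (Fin M) k)) (f₀ i)) (relH k U U₀)

/-- `rels` on an old index. [folklore] -/
@[simp]
theorem rels_castSucc (i : Fin c) :
    rels k f₀ U U₀ i.castSucc = MvPolynomial.map (algebraMap k (MvPolynomial (Fin M) k)) (f₀ i) := by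
  simp [rels]

/-- `rels` on the new index. [folklore] -/
@[simp]
theorem rels_last : rels k f₀ U U₀ (Fin.last c) = relH k U U₀ := by
  simp [rels]

/-- The images `t_a = eA [T_a] ∈ A ⊆ A[y'']` of the generators. [folklore] -/
def tgen (a : Fin mT) : Model A m₀ :=
  algebraMap A (Model A m₀) (eA (Ideal.Quotient.mk _ (X a)))

/-- `p(t) = eA [p]` for every polynomial `p ∈ k[T]` (both sides are `k`-algebra maps in `p` agreeing on
the variables). [folklore] -/
theorem aeval_tgen (p : MvPolynomial (Fin mT) k) :
    aeval (R := k) (tgen k A m₀ f₀ eA) p =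
      algebraMap A (Model A m₀) (eA (Ideal.Quotient.mk _ p)) := by
  change (aeval (R := k) (tgen k A m₀ f₀ eA)) p =
    ((IsScalarTower.toAlgHom k A (Model A m₀)).comp
      (eA.toAlgHom.comp (Ideal.Quotient.mkₐ k (Ideal.span (Set.range f₀))))) p
  congr 1
  refine MvPolynomial.algHom_ext fun a ↦ ?_
  simp [tgen]

/-- `p(y ↦ subst, T ↦ t) = eA [p]` for `p ∈ k[T]` read in `k[y][T]`. [folklore] -/
theorem eval₂_tgen_map (p : MvPolynomial (Fin mT) k) :
    eval₂ (aeval (R := k) (subst A m₀ w w₀)).toRingHom (tgen k A m₀ f₀ eA)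
        (MvPolynomial.map (algebraMap k (MvPolynomial (Fin M) k)) p) =
      algebraMap A (Model A m₀) (eA (Ideal.Quotient.mk _ p)) := by
  letI := modelAlgebra k A m₀ w w₀
  haveI := modelAlgebra_isScalarTower k A m₀ w w₀
  rw [← aeval_tgen k A m₀ f₀ eA p, ← aeval_map_algebraMap (MvPolynomial (Fin M) k)]
  rfl

variable {k A m₀ w w₀ f₀ eA U U₀}

/-- **The relations hold in the model.** Under `T_a ↦ t_a`, `y ↦ subst`, every relation of `rels`
maps to `0`: the `f₀ⱼ` because they vanish in `A`, and `h ↦ elim g = 0`. Hypotheses: the `U_m`, `U₀`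
lift the `w_m`, `w₀`, and `w_{m₀} = 1`. [folklore] -/
theorem eval₂_rels_eq_zero (hU : ∀ m, eA (Ideal.Quotient.mk _ (U m)) = w m)
    (hU₀ : eA (Ideal.Quotient.mk _ U₀) = w₀) (hw : w m₀ = 1) (i : Fin (c + 1)) :
    eval₂ (aeval (R := k) (subst A m₀ w w₀)).toRingHom (tgen k A m₀ f₀ eA) (rels k f₀ U U₀ i) = 0 := by
  letI := modelAlgebra k A m₀ w w₀
  haveI := modelAlgebra_isScalarTower k A m₀ w w₀
  have hmap : ∀ p : MvPolynomial (Fin mT) k,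
      eval₂ (aeval (R := k) (subst A m₀ w w₀)).toRingHom (tgen k A m₀ f₀ eA)
        (MvPolynomial.map (algebraMap k (MvPolynomial (Fin M) k)) p) =
      algebraMap A (Model A m₀) (eA (Ideal.Quotient.mk _ p)) := fun p ↦ by
    rw [← aeval_tgen k A m₀ f₀ eA p, ← aeval_map_algebraMap (MvPolynomial (Fin M) k)]
    rfl
  refine Fin.lastCases ?_ (fun i ↦ ?_) i
  · rw [rels_last, relH, eval₂_add, eval₂_sum]
    simp only [eval₂_mul, eval₂_C, hmap, hU, hU₀]
    simp only [AlgHom.toRingHom_eq_coe, AlgHom.coe_toRingHom, aeval_X]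
    have key : (∑ m : Fin M, subst A m₀ w w₀ m * algebraMap A (Model A m₀) (w m)) +
        algebraMap A (Model A m₀) w₀ = elim A m₀ w w₀ (incidence A w w₀) := by
      simp only [elim, incidence, map_add, map_sum, map_mul, aeval_C, aeval_X]
      rw [add_comm]
      exact congrArg (algebraMap A (Model A m₀) w₀ + ·) (Finset.sum_congr rfl fun m _ ↦ mul_comm _ _)
    rw [key]
    exact elim_incidence hw
  · have h0 : (Ideal.Quotient.mk (Ideal.span (Set.range f₀)) (f₀ i)) = 0 :=
      Ideal.Quotient.eq_zero_iff_mem.2 (Ideal.subset_span ⟨i, rfl⟩)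
    rw [rels_castSucc, hmap, h0, map_zero, map_zero]

variable (k A m₀ w w₀ f₀ eA U U₀)

/-- The forward map of the presentation, `k[y][T]/(rels) → A[y_m : m ≠ m₀]` (as a ring map).
[folklore] -/
def fwd (hU : ∀ m, eA (Ideal.Quotient.mk _ (U m)) = w m) (hU₀ : eA (Ideal.Quotient.mk _ U₀) = w₀)
    (hw : w m₀ = 1) : Smoothening.Quot (rels k f₀ U U₀) →+* Model A m₀ :=
  Ideal.Quotient.lift _ (eval₂Hom (aeval (R := k) (subst A m₀ w w₀)).toRingHom (tgen k A m₀ f₀ eA))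
    fun p hp ↦ by
      have hle : Ideal.span (Set.range (rels k f₀ U U₀)) ≤
          RingHom.ker (eval₂Hom (aeval (R := k) (subst A m₀ w w₀)).toRingHom (tgen k A m₀ f₀ eA)) :=
        Ideal.span_le.2 (Set.range_subset_iff.2 fun i ↦ eval₂_rels_eq_zero hU hU₀ hw i)
      exact hle hp

/-- `fwd [p] = p(y ↦ subst, T ↦ t)`. [folklore] -/
theorem fwd_mk (hU : ∀ m, eA (Ideal.Quotient.mk _ (U m)) = w m) (hU₀ : eA (Ideal.Quotient.mk _ U₀) = w₀)
    (hw : w m₀ = 1) (p : MvPolynomial (Fin mT) (MvPolynomial (Fin M) k)) :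
    fwd k A m₀ w w₀ f₀ eA U U₀ hU hU₀ hw (Ideal.Quotient.mk _ p) =
      eval₂ (aeval (R := k) (subst A m₀ w w₀)).toRingHom (tgen k A m₀ f₀ eA) p :=
  Ideal.Quotient.lift_mk _ _ _

/-- `k[T]/(f₀) → k[y][T]/(rels)`, `[p] ↦ [p]` (the old relations are among the new ones). [folklore] -/
def baseToQuot : (MvPolynomial (Fin mT) k ⧸ Ideal.span (Set.range f₀)) →+* Smoothening.Quot (rels k f₀ U U₀) :=
  Ideal.Quotient.lift _
    ((Ideal.Quotient.mk _).comp (MvPolynomial.map (algebraMap k (MvPolynomial (Fin M) k))))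
    fun p hp ↦ by
      have hle : Ideal.span (Set.range f₀) ≤ RingHom.ker ((Ideal.Quotient.mk
          (Ideal.span (Set.range (rels k f₀ U U₀)))).comp
            (MvPolynomial.map (algebraMap k (MvPolynomial (Fin M) k)))) :=
        Ideal.span_le.2 (Set.range_subset_iff.2 fun i ↦ by
          rw [SetLike.mem_coe, RingHom.mem_ker, RingHom.comp_apply, ← rels_castSucc k f₀ U U₀ i,
            Ideal.Quotient.eq_zero_iff_mem]
          exact Ideal.subset_span ⟨i.castSucc, rfl⟩)
      exact hle hp

/-- `baseToQuot [p] = [p]`. [folklore] -/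
@[simp]
theorem baseToQuot_mk (p : MvPolynomial (Fin mT) k) :
    baseToQuot k f₀ U U₀ (Ideal.Quotient.mk _ p) =
      Ideal.Quotient.mk _ (MvPolynomial.map (algebraMap k (MvPolynomial (Fin M) k)) p) :=
  Ideal.Quotient.lift_mk _ _ _

/-- The ring map `A → k[y][T]/(rels)` (through `A ≅ k[T]/(f₀)`). [folklore] -/
def algA : A →+* Smoothening.Quot (rels k f₀ U U₀) :=
  (baseToQuot k f₀ U U₀).comp eA.symm.toRingEquiv.toRingHom

/-- `algA (eA [p]) = [p]`. [folklore] -/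
theorem algA_eA_mk (p : MvPolynomial (Fin mT) k) :
    algA k A f₀ eA U U₀ (eA (Ideal.Quotient.mk _ p)) =
      Ideal.Quotient.mk _ (MvPolynomial.map (algebraMap k (MvPolynomial (Fin M) k)) p) := by
  change baseToQuot k f₀ U U₀ (eA.symm (eA (Ideal.Quotient.mk _ p))) = _
  rw [AlgEquiv.symm_apply_apply, baseToQuot_mk]

/-- `algA` on scalars: `algA (c · 1) = [C (C c)]`. [folklore] -/
theorem algA_algebraMap (c' : k) :
    algA k A f₀ eA U U₀ (algebraMap k A c') = Ideal.Quotient.mk _ (C (C c')) := by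
  have h : algebraMap k A c' = eA (Ideal.Quotient.mk _ (C c')) := (eA.commutes c').symm
  rw [h, algA_eA_mk, map_C]
  rfl

/-- The backward map of the presentation, `A[y_m : m ≠ m₀] → k[y][T]/(rels)`: `a ↦ algA a`,
`y_m ↦ [y_m]`. [folklore] -/
def bwd : Model A m₀ →+* Smoothening.Quot (rels k f₀ U U₀) :=
  eval₂Hom (algA k A f₀ eA U U₀) fun m : Idx m₀ ↦ Ideal.Quotient.mk _ (C (X m.1))

variable {k A m₀ w w₀ f₀ eA U U₀}

/-- **`fwd ∘ bwd = id`** (check on `A` and on the `y_m`). [folklore] -/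
theorem fwd_comp_bwd (hU : ∀ m, eA (Ideal.Quotient.mk _ (U m)) = w m) (hU₀ : eA (Ideal.Quotient.mk _ U₀) = w₀)
    (hw : w m₀ = 1) :
    (fwd k A m₀ w w₀ f₀ eA U U₀ hU hU₀ hw).comp (bwd k A m₀ f₀ eA U U₀) = RingHom.id _ := by
  refine MvPolynomial.ringHom_ext (fun a ↦ ?_) (fun m ↦ ?_)
  · obtain ⟨p, hp⟩ := Ideal.Quotient.mk_surjective (eA.symm a)
    have ha : a = eA (Ideal.Quotient.mk _ p) := by rw [hp, AlgEquiv.apply_symm_apply]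
    rw [RingHom.comp_apply, RingHom.id_apply, bwd, eval₂Hom_C, ha, algA_eA_mk, fwd_mk, eval₂_tgen_map]
    rfl
  · rw [RingHom.comp_apply, RingHom.id_apply, bwd, eval₂Hom_X', fwd_mk, eval₂_C, AlgHom.toRingHom_eq_coe,
      AlgHom.coe_toRingHom, aeval_X, subst_of_ne A m₀ w w₀ m.2]

/-- **The eliminated coordinate in the quotient**: `[y_{m₀}] = bwd (-G)`, i.e.
`[y_{m₀}] = -(algA w₀ + Σ_{m ≠ m₀} algA w_m · [y_m])` in `k[y][T]/(rels)` (from the relation `h`).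
[folklore] -/
theorem mk_C_X_self (hU : ∀ m, eA (Ideal.Quotient.mk _ (U m)) = w m) (hU₀ : eA (Ideal.Quotient.mk _ U₀) = w₀)
    (hw : w m₀ = 1) :
    Ideal.Quotient.mk (Ideal.span (Set.range (rels k f₀ U U₀))) (C (X m₀)) =
      bwd k A m₀ f₀ eA U U₀ (-G A m₀ w w₀) := by
  set q := Ideal.Quotient.mk (Ideal.span (Set.range (rels k f₀ U U₀))) with hq
  have hrel : q (relH k U U₀) = 0 :=
    Ideal.Quotient.eq_zero_iff_mem.2 (Ideal.subset_span ⟨Fin.last c, rels_last k f₀ U U₀⟩)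
  have hmapU : ∀ m, q (MvPolynomial.map (algebraMap k (MvPolynomial (Fin M) k)) (U m)) =
      algA k A f₀ eA U U₀ (w m) := fun m ↦ by rw [← hU m, algA_eA_mk]
  have hmapU₀ : q (MvPolynomial.map (algebraMap k (MvPolynomial (Fin M) k)) U₀) = algA k A f₀ eA U U₀ w₀ := by
    rw [← hU₀, algA_eA_mk]
  rw [relH, map_add, map_sum, sum_eq_add_sum_subtype (m₀ := m₀)] at hrel
  simp only [map_mul, hmapU, hmapU₀, hw, map_one, mul_one] at hrel
  have hG : bwd k A m₀ f₀ eA U U₀ (G A m₀ w w₀) =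
      algA k A f₀ eA U U₀ w₀ + ∑ m : Idx m₀, algA k A f₀ eA U U₀ (w m.1) * q (C (X m.1)) := by
    simp only [G, bwd, map_add, map_sum, map_mul, eval₂Hom_C, eval₂Hom_X']
    rfl
  have hsum : ∑ m : Idx m₀, q (C (X m.1)) * algA k A f₀ eA U U₀ (w m.1) =
      ∑ m : Idx m₀, algA k A f₀ eA U U₀ (w m.1) * q (C (X m.1)) :=
    Finset.sum_congr rfl fun m _ ↦ mul_comm (q (C (X m.1))) (algA k A f₀ eA U U₀ (w m.1))
  rw [hsum] at hrel
  rw [map_neg, hG]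
  linear_combination hrel

/-- **`bwd ∘ fwd = id`** (check on the scalars `k[y]` — where the relation `h` enters through
`mk_C_X_self` — and on the `T_a`). [folklore] -/
theorem bwd_comp_fwd (hU : ∀ m, eA (Ideal.Quotient.mk _ (U m)) = w m) (hU₀ : eA (Ideal.Quotient.mk _ U₀) = w₀)
    (hw : w m₀ = 1) :
    (bwd k A m₀ f₀ eA U U₀).comp (fwd k A m₀ w w₀ f₀ eA U U₀ hU hU₀ hw) = RingHom.id _ := by
  refine Ideal.Quotient.ringHom_ext (MvPolynomial.ringHom_ext (fun b ↦ ?_) (fun a ↦ ?_))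
  · rw [RingHom.comp_apply, RingHom.comp_apply, RingHom.comp_apply, RingHom.id_apply, fwd_mk, eval₂_C]
    -- `bwd (b(subst)) = [C b]` for `b ∈ k[y]`: both sides are ring maps in `b`
    change ((bwd k A m₀ f₀ eA U U₀).comp (aeval (R := k) (subst A m₀ w w₀)).toRingHom) b =
      ((Ideal.Quotient.mk (Ideal.span (Set.range (rels k f₀ U U₀)))).comp MvPolynomial.C) b
    congr 1
    refine MvPolynomial.ringHom_ext (fun c' ↦ ?_) (fun m ↦ ?_)
    · rw [RingHom.comp_apply, RingHom.comp_apply, AlgHom.toRingHom_eq_coe, AlgHom.coe_toRingHom, aeval_C]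
      change bwd k A m₀ f₀ eA U U₀ (C (algebraMap k A c')) = _
      rw [bwd, eval₂Hom_C, algA_algebraMap]
    · rw [RingHom.comp_apply, RingHom.comp_apply, AlgHom.toRingHom_eq_coe, AlgHom.coe_toRingHom, aeval_X]
      by_cases hm : m = m₀
      · subst hm
        rw [subst_self, mk_C_X_self hU hU₀ hw]
      · rw [subst_of_ne A m₀ w w₀ hm, bwd, eval₂Hom_X']
  · rw [RingHom.comp_apply, RingHom.comp_apply, RingHom.comp_apply, RingHom.id_apply, fwd_mk, eval₂_X]
    change bwd k A m₀ f₀ eA U U₀ (C (eA (Ideal.Quotient.mk _ (X a)))) = _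
    rw [bwd, eval₂Hom_C, algA_eA_mk, map_X]

variable (k A m₀ w w₀ f₀ eA U U₀)

/-- **The presentation of the model**: `k[y₁, …, y_M][T₁, …, T_{mT}]/(f₀, h) ≃ A[y_m : m ≠ m₀]` as
rings (`T ↦ t`, `y ↦ subst`; inverse `a ↦ algA a`, `y_m ↦ [y_m]`). It is an isomorphism of
`k[y]`-algebras for the structure `modelAlgebra` on the model (`fwd_algebraMap`).
[cite: VoisinHodgeII2003, §2.1.1] -/
def presentationEquiv (hU : ∀ m, eA (Ideal.Quotient.mk _ (U m)) = w m) (hU₀ : eA (Ideal.Quotient.mk _ U₀) = w₀)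
    (hw : w m₀ = 1) : Smoothening.Quot (rels k f₀ U U₀) ≃+* Model A m₀ :=
  RingEquiv.ofRingHom (fwd k A m₀ w w₀ f₀ eA U U₀ hU hU₀ hw) (bwd k A m₀ f₀ eA U U₀)
    (fwd_comp_bwd hU hU₀ hw) (bwd_comp_fwd hU hU₀ hw)

/-- The forward map is `k[y]`-linear for the structure `modelAlgebra`. [folklore] -/
theorem fwd_algebraMap (hU : ∀ m, eA (Ideal.Quotient.mk _ (U m)) = w m) (hU₀ : eA (Ideal.Quotient.mk _ U₀) = w₀)
    (hw : w m₀ = 1) (b : MvPolynomial (Fin M) k) :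
    fwd k A m₀ w w₀ f₀ eA U U₀ hU hU₀ hw (algebraMap (MvPolynomial (Fin M) k) _ b) =
      aeval (R := k) (subst A m₀ w w₀) b := by
  change fwd k A m₀ w w₀ f₀ eA U U₀ hU hU₀ hw (Ideal.Quotient.mk _ (C b)) = _
  rw [fwd_mk, eval₂_C]
  rfl

/-- The presentation as an isomorphism of `k[y]`-algebras (structure `modelAlgebra` on the model).
[cite: VoisinHodgeII2003, §2.1.1] -/
def presentationAlgEquiv (hU : ∀ m, eA (Ideal.Quotient.mk _ (U m)) = w m) (hU₀ : eA (Ideal.Quotient.mk _ U₀) = w₀)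
    (hw : w m₀ = 1) :
    letI := modelAlgebra k A m₀ w w₀
    Smoothening.Quot (rels k f₀ U U₀) ≃ₐ[MvPolynomial (Fin M) k] Model A m₀ :=
  letI := modelAlgebra k A m₀ w w₀
  { presentationEquiv k A m₀ w w₀ f₀ eA U U₀ hU hU₀ hw with
    commutes' := fun b ↦ fwd_algebraMap k A m₀ w w₀ f₀ eA U U₀ hU hU₀ hw b }

end Presentation

/-! ### Finite presentations indexed by `Fin` -/

section FinPresentation

/-- **A standard smooth algebra of relative dimension `d` has a presentation
`k[T₁, …, T_m]/(f₁, …, f_c) ≃ A` with `m - c = d` and `c ≤ m`** (reindex a submersive presentation by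
`Fin`; Mathlib `Algebra.Presentation.reindex`, `Ideal.quotientKerAlgEquivOfSurjective`). [folklore] -/
theorem exists_fin_presentation (k A : Type u) [CommRing k] [CommRing A] [Algebra k A] (d : ℕ)
    [Algebra.IsStandardSmoothOfRelativeDimension d k A] :
    ∃ (mT c : ℕ) (f₀ : Fin c → MvPolynomial (Fin mT) k), mT - c = d ∧ c ≤ mT ∧
      Nonempty ((MvPolynomial (Fin mT) k ⧸ Ideal.span (Set.range f₀)) ≃ₐ[k] A) := by
  obtain ⟨ι, σ, _, _, P, hP⟩ := ‹Algebra.IsStandardSmoothOfRelativeDimension d k A›.out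
  haveI := Fintype.ofFinite ι
  haveI := Fintype.ofFinite σ
  let P' := P.reindex (Fintype.equivFin ι).symm (Fintype.equivFin σ).symm
  refine ⟨Fintype.card ι, Fintype.card σ, P'.relation, ?_, ?_, ?_⟩
  · have h' : P'.toPresentation.dimension = d := by
      change (P.toPresentation.reindex _ _).dimension = d
      rw [Algebra.Presentation.dimension_reindex]; exact hP
    rw [Algebra.Presentation.dimension, Nat.card_eq_fintype_card, Nat.card_eq_fintype_card,
      Fintype.card_fin, Fintype.card_fin] at h'
    exact h'
  · have h := P'.card_relations_le_card_vars_of_isFinite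
    rwa [Nat.card_eq_fintype_card, Nat.card_eq_fintype_card, Fintype.card_fin, Fintype.card_fin] at h
  · have h1 : Ideal.span (Set.range P'.relation) = RingHom.ker (aeval (R := k) P'.val) := by
      rw [P'.span_range_relation_eq_ker, Algebra.Generators.ker_eq_ker_aeval_val]
    exact ⟨(Ideal.quotientEquivAlgOfEq k h1).trans
      (Ideal.quotientKerAlgEquivOfSurjective P'.toGenerators.aeval_val_surjective)⟩

end FinPresentation






end Literature.AlgebraicGeometry.Motives.HyperplaneSectionChart

end
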